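import Summits.QuantumFields.YangMills.Theorems.BalabanUVNodesN22W1PrintedBoxWindowCap
import Summits.QuantumFields.YangMills.Theorems.BalabanUVNodesN22W1RelCentredSliceInputsL2UWitness
import Literature.MathematicalPhysics.QuantumFieldTheory.Balaban1983to89.B13TermWalkDataOneTorus

/-!
# BalabanUVNodes ∕ node N22 = NE9 — A6 FOR THE PRINTED BOX BLOCK: `SliceInputsLGU` ∕ `SliceInputsL2U` ARE INHABITED AT A LARGE-FIELD LABEL WITH PRINT'S CHARACTERISTIC FUNCTIONS
# (threshold `ε₁` on the unscaled field; large-field function `Π_{b∈P} χ(|B(b)| ≥ ε₁∕s₀)` at the base point), under the window relations `20·a⁺ ≤ (ε₁∕s₀)²` and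
# `e^{−((ε₁∕s₀)² − 20a⁺)∕40} ≤ Mv·s₀²`; hence the window-cap theorems of `…PrintedBoxWindowCap` are NON-VACUOUS

Cell `pub-ymgap`, HUMAN RULING D-0062 (Track A) ∕ D-0149 (width seats), seat `pub-ymgap-dag-n22-w1` (WIDTH SEAT 1 of 3 on node n22; «A6-residue flag №3 lane»), generation 0, file 4.
THEOREMS ONLY (0 `def`, 0 `sorry`); imports this seat's `…PrintedBoxWindowCap` (through it file 1 and dag-n22-c's J17-D), dag-n22-c's J17-W `…SliceInputsL2UWitness`
(`SliceInputsLGU.nonempty_sliceInputsL2U_of_vanishing`, `zero_mem_AdmHist_of_nonneg`; through it J12-D `SliceInputsLGU`) and `B13TermWalkDataOneTorus` (NODE A's FREE kernels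
`freeKernels`); restates nothing.  `--kind proof --supports stmt-QuantumFields-20544 --as helper` (K3⁷ `SpineGivenEndpointR13SepCoPH`).

WHY (standing rule №189 ∕ director-ym №193, A6).  The tree's inhabitants of the s1 records take DEGENERATE boxes: J12-Wb ∕ J13b (`P(t) = ∅`) the constant boxes `χ ≡ 1` with EMPTY
box support, J12-W ∕ J13a (`1 ≤ |P(t)|`) the VANISHING boxes `χ ≡ 0` ((2.22) read as `0 ≤ exp`).  This seat's files 1–3 discharge ∕ constrain the box block at PRINT'S boxes; THIS
FILE is their A6 companion: `SliceInputsLGU` — and through J17-W `SliceInputsL2U` — IS INHABITED at a large-field label `|P(t)| = 1` with `χᵘ(A) = Π_{b∈∅} χ(|A(b)| < ε₁)` (no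
small-field row bond) and `χᶜᵘ(A) = Π_{b∈Λ} χ(ε₁ ≤ |A(b)|)` (the one row bond of the free kernels IS the large-field bond), (2.22) at the FORCED threshold `rP = ε₁∕s₀` (file 1
`chi_mul_chic_le_exp_222`), surplus letters `r₁² = 20·a⁺`, `TP = Mv` — PROVIDED the two window relations the forced threshold imposes: `20·a⁺ ≤ (ε₁∕s₀)²` (`hr₁ ∕ hPa`) and
`e^{−((ε₁∕s₀)² − 20a⁺)∕40} ≤ Mv·s₀²` (`hTP ∕ hMvP`).  Everything else is J12-W's witness VERBATIM (free kernels on one row bond, `uOf ≡ 0`, Cauchy radius `1`, zero potentials,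
`W := univ`).  §2 transports it to `SliceInputsL2U` and records that the hypotheses of `…PrintedBoxWindowCap` §2 are met (`Y₀ := ∅`, `Pl := univ`, `|Pl| = |P(t)| = 1`), so
the cap `2·a·cE·s₀² ≤ ε₁²` speaks about an inhabited class.

HONEST FRAMING — what this is NOT.  An INHABITATION witness at DEGENERATE kernel data with print's box SHAPES on one row bond; NOTHING of Bałaban's asserted (the datum of record, its
row-bond sets and thresholds are the definers'); a JOINT witness with the knit's tables ∕ numerals ∕ `hlaw` ∕ N18-below is NOT claimed (the window relations above are what a print-box
joint witness must add to dag-n22-c's J13 ∕ J17-W §3 ∕ J21 lineage); count-neutral; N22 NOT discharged (typed 28∕28 · discharged 5∕27 UNCHANGED); one finite four-torus programme at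
fixed ε — R4 closes the conditional rung `BalabanLadder.UV` only; NOT continuum, NOT OS, NOT a mass gap, NOT Clay.  0 `sorry`, standard axioms.

References (TYPES only): [II] = [Balaban1988RG2Cluster] (1.5) p. 3, (2.3) p. 12, (2.14) p. 15, (2.22) p. 16; [I] = [Balaban1987RG1] (2.9)–(2.13) pp. 266–268.
-/

noncomputable section

namespace Summit.QuantumFields.YangMills.BalabanUVNodes.N22PrintedBoxBlock

open Set Metric Matrix
open scoped BigOperators
open Literature.MathematicalPhysics.QuantumFieldTheory.Balaban1983to89
open Literature.MathematicalPhysics.QuantumFieldTheory.Balaban1983to89.TreeLengthTorus (TPt TDom tsys torusTreeLen torusTreeLen_nonneg)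
open Literature.MathematicalPhysics.QuantumFieldTheory.Balaban1983to89.B13Bound143 (invTau invTau_pos)
open Literature.MathematicalPhysics.QuantumFieldTheory.Balaban1983to89.B9Thm37GlueTorus (tdist1 tdist1_self)
open Literature.MathematicalPhysics.QuantumFieldTheory.Balaban1983to89.B5TorusCover (UT)
open Literature.MathematicalPhysics.QuantumFieldTheory.Balaban1983to89.B13TermWalkDataOneTorus (freeKernels)
open Literature.MathematicalPhysics.QuantumFieldTheory.Balaban1983to89.B13Term214 (term214 core214 F214)
open Literature.MathematicalPhysics.QuantumFieldTheory.Balaban1983to89.Step (SFConsts)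
open Literature.MathematicalPhysics.QuantumFieldTheory.Balaban1983to89.Node00
open Literature.MathematicalPhysics.QuantumFieldTheory.Balaban1983to89.Node00.Sect2 (domSys domCount CPair spaceI domSites Setting Residual)
open Literature.MathematicalPhysics.QuantumFieldTheory.Balaban1983to89.Node00.W1
open YMDAG.N22.W1 (SliceInputsLGU SliceInputsL2U)

variable (c : B13.Consts) (P : Params) (𝔸 : Type*) [NormedRing 𝔸] [NormedAlgebra ℂ 𝔸] [CompleteSpace 𝔸] (M k L : ℕ) [NeZero L]

/-! ## §1 `SliceInputsLGU` inhabited at a large-field label `|P(t)| = 1` with print's boxes -/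

open Classical in
/-- **★ `SliceInputsLGU` IS INHABITED ON `W := univ` AT EVERY LABEL WITH `|P(t)| = 1` WITH PRINT'S BOXES** — `χᵘ(A) = Π_{b∈∅} χ(|A(b)| < ε₁)`, `χᶜᵘ(A) = Π_{b∈Λ} χ(ε₁ ≤ |A(b)|)` on the one row bond
of the free kernels, zero potentials — for every nonempty domain `Z`, tables, size letters, weight letter `a` and base point `s₀ > 0` under the two WINDOW RELATIONS of the forced threshold
`rP = ε₁∕s₀`: `20·a⁺ ≤ (ε₁∕s₀)²` and `e^{−((ε₁∕s₀)² − 20a⁺)∕40} ≤ Mv·s₀²`; at `ρb = 1∕12`, `a₅ = 2`, constants as in J12-W.  A6 witness at degenerate kernel data; nothing of Bałaban's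
construction. [cite: Balaban1987RG1, (2.9) p.266; Balaban1988RG2Cluster, (2.3) p.12 and (2.22) p.16 (degenerate kernel data; bookkeeping)] -/
theorem sliceInputsLGU_inhabited_largeField_printedBoxes (hκ₁ : 1 ≤ c.κ₁) (hE : 0 < c.E₀) (hε : 0 < c.ε₁) (hC₁ : 0 < c.C₁) (hα : 0 < c.α₄) (hMc : 0 < c.M)
    (hδκ : 0 ≤ (1 - 3 * c.δ) * c.κ) (hpref : c.E₀ * c.ε₁ * c.C₁ * c.α₄⁻¹ * c.M ^ c.q * Real.exp (c.C₂ * c.κ₁) ≤ 1 / 2)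
    {G : Type*} [GaugeGroup G] (Sg : Setting 𝔸 G) (Rz : Residual P 𝔸) (cs : SFConsts) (E₀ κE : ℝ)
    (Z : (domSys P M (k + 1)).Dom) (hZ : 1 ≤ (Z.1).card) (t : TermLabel P M k L) (hP : t.2.card = 1)
    {s₀ Mv : ℝ} (hs₀ : 0 < s₀) (a : ℝ) (ha : 20 * max a 0 ≤ (c.ε₁ / s₀) ^ 2)
    (hMv : Real.exp (-(((c.ε₁ / s₀) ^ 2 - 20 * max a 0) / 40)) ≤ Mv * s₀ ^ 2) :
    ∃ (𝔇 : TermDatum214 c P 𝔸 M k L)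
      (χu χcu : (Z : (domSys P M (k + 1)).Dom) → (t : TermLabel P M k L) → ((𝔇.𝒦 Z t).Λ → ℝ) → ℝ)
      (𝒲 : (Z : (domSys P M (k + 1)).Dom) → (t : TermLabel P M k L) → CPair P 𝔸 → TDom P.d (L * domCount P M (k + 1)) → ((𝔇.𝒦 Z t).Λ → ℝ) → ℂ)
      (𝒪 : (Z : (domSys P M (k + 1)).Dom) → (t : TermLabel P M k L) → OlderTerms P 𝔸 M k → CPair P 𝔸 → TDom P.d (L * domCount P M (k + 1)) →
        ((𝔇.𝒦 Z t).Λ → ℝ) → ℂ),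
      (∀ Z' t' A, χu Z' t' A = ∏ b ∈ (∅ : Finset (𝔇.𝒦 Z' t').Λ), (if |A b| < c.ε₁ then (1 : ℝ) else 0)) ∧
      (∀ Z' t' A, χcu Z' t' A = ∏ b ∈ (Finset.univ : Finset (𝔇.𝒦 Z' t').Λ), (if c.ε₁ ≤ |A b| then (1 : ℝ) else 0)) ∧
      (∀ Z' t' φ Y A, 𝒲 Z' t' φ Y A = 0) ∧ (∀ Z' t' old φ Y A, 𝒪 Z' t' old φ Y A = 0) ∧
      (∀ Z' t', (Finset.univ : Finset (𝔇.𝒦 Z' t').Λ).card = 1) ∧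
      Nonempty (SliceInputsLGU 𝔇 χu χcu 𝒲 𝒪 c Sg Rz cs E₀ κE Z t Set.univ s₀ a 2 (1 / 12) Mv) := by
  haveI hNe : ∀ i : Fin 0, NeZero ((![] : Fin 0 → ℕ) i) := fun i => i.elim0
  let z : UT (![] : Fin 0 → ℕ) := UT.ofSite (N := (![] : Fin 0 → ℕ)) fun i => i.elim0
  -- W1-7's degenerate datum, kept OPAQUE (an equation `h𝔇`) so that the record's baked instances are found syntactically
  obtain ⟨𝔇, h𝔇⟩ : ∃ 𝔇 : TermDatum214 c P 𝔸 M k L, 𝔇 =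
      { ν := 0, Nf := ![], E₃ := ℂ,
        𝒦 := fun _ _ => freeKernels c ℂ Unit Empty (fun _ => z) (fun _ => z),
        finC₀ := fun _ _ => inferInstanceAs (Fintype Empty),
        decC₀ := fun _ _ => inferInstanceAs (DecidableEq Empty),
        uOf := fun _ _ _ => 0, r := 1,
        chiY₀ := fun _ _ _ _ => 0, chicP := fun _ _ _ _ => 0,
        𝒱 := fun _ _ _ _ _ _ _ => 0 } := ⟨_, rfl⟩
  have hPne : t.2 ≠ ∅ := fun h => by rw [h, Finset.card_empty] at hP; exact Nat.zero_ne_one hP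
  -- the datum's reductions (by `subst`, each in its own `have`)
  have hA1 : ∀ (ψ : CPair P 𝔸) (σ : TPt P.d (domCount P M (k + 1)) → ℂ), 𝔇.A Z t ψ σ = 1 := by intro ψ σ; subst h𝔇; rfl
  have hG0 : ∀ (σ : TPt P.d (domCount P M (k + 1)) → ℂ) (ψ : CPair P 𝔸), (𝔇.𝒦 Z t).G2 σ (𝔇.uOf Z t ψ) = 0 := by intro σ ψ; subst h𝔇; rfl
  have hΓ0 : (𝔇.𝒦 Z t).Γ₀ = 0 := by subst h𝔇; rfl
  have hC1 : (𝔇.𝒦 Z t).C = 1 := by subst h𝔇; rfl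
  have hm : (𝔇.𝒦 Z t).m = 1 := by subst h𝔇; rfl
  have hpow : ∀ x : ℝ, x ^ 𝔇.ν = 1 := fun x => by subst h𝔇; exact pow_zero x
  have hr1 : 𝔇.r = 1 := by subst h𝔇; rfl
  have hGam : ∀ (ψ : CPair P 𝔸) (σ : TPt P.d (domCount P M (k + 1)) → ℂ) (X : (𝔇.𝒦 Z t).Λ ⊕ (𝔇.𝒦 Z t).C₀ → ℝ), 𝔇.Gam Z t ψ σ X = 0 := by
    intro ψ σ X; rw [TermDatum214.Gam, hG0, Matrix.zero_mulVec]
  have hcardΛ : Fintype.card (𝔇.𝒦 Z t).Λ = 1 := by subst h𝔇; exact Fintype.card_unit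
  have hcardΛC : Fintype.card ((𝔇.𝒦 Z t).Λ ⊕ (𝔇.𝒦 Z t).C₀) = 1 := by
    have h0 : Fintype.card (𝔇.𝒦 Z t).C₀ = 0 := Fintype.card_eq_zero_iff.2 ⟨fun x => by subst h𝔇; exact Empty.elim x⟩
    rw [Fintype.card_sum, hcardΛ, h0]
  have hcardAll : ∀ Z' t', (Finset.univ : Finset (𝔇.𝒦 Z' t').Λ).card = 1 := by
    intro Z' t'; rw [Finset.card_univ]; subst h𝔇; exact Fintype.card_unit
  -- W1-8's located τ-letters from the elementary conditions on `c`
  have hposY : ∀ Y : TDom P.d (L * domCount P M (k + 1)), 0 < invTau c ((tsys P.d (L * domCount P M (k + 1))).dj Y) := fun Y =>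
    invTau_pos c hE hε hC₁ hα hMc _
  have hhalfY : ∀ Y : TDom P.d (L * domCount P M (k + 1)), invTau c ((tsys P.d (L * domCount P M (k + 1))).dj Y) ≤ 1 / 2 := by
    intro Y
    have hd : 0 ≤ (tsys P.d (L * domCount P M (k + 1))).dj Y := torusTreeLen_nonneg Y.1
    have hpref0 : 0 ≤ c.E₀ * c.ε₁ * c.C₁ * c.α₄⁻¹ * c.M ^ c.q * Real.exp (c.C₂ * c.κ₁) := by positivity
    unfold invTau
    calc c.E₀ * c.ε₁ * c.C₁ * c.α₄⁻¹ * c.M ^ c.q * Real.exp (c.C₂ * c.κ₁) * Real.exp (-(1 - 3 * c.δ) * c.κ * (tsys P.d (L * domCount P M (k + 1))).dj Y)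
        ≤ c.E₀ * c.ε₁ * c.C₁ * c.α₄⁻¹ * c.M ^ c.q * Real.exp (c.C₂ * c.κ₁) * 1 := by
          refine mul_le_mul_of_nonneg_left (Real.exp_le_one_iff.2 ?_) hpref0
          have : 0 ≤ (1 - 3 * c.δ) * c.κ * (tsys P.d (L * domCount P M (k + 1))).dj Y := mul_nonneg hδκ hd
          linarith
      _ ≤ 1 / 2 := by rw [mul_one]; exact hpref
  -- PRINT'S threshold in the unscaled field read at the base point: `rP := ε₁ ∕ s₀`; the window letter `r₁² := 20·a⁺ ≤ rP²`
  set r₁ : ℝ := Real.sqrt (20 * max a 0) with hr₁def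
  set rP : ℝ := c.ε₁ / s₀ with hrPdef
  have hr₁sq : r₁ ^ 2 = 20 * max a 0 := Real.sq_sqrt (by positivity)
  have hrP0 : 0 ≤ rP := div_nonneg hε.le hs₀.le
  have hrPs : rP * s₀ ≤ c.ε₁ := by rw [hrPdef, div_mul_cancel₀ c.ε₁ hs₀.ne']
  have hcardle : t.2.card ≤ (Finset.univ : Finset (𝔇.𝒦 Z t).Λ).card := by rw [Finset.card_univ, hcardΛ, hP]
  -- print's boxes on the record's row bonds: NO small-field bond (`Y₀l = ∅`), the ONE row bond large (`Pl = univ`)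
  refine ⟨𝔇, fun Z' t' A => ∏ b ∈ (∅ : Finset (𝔇.𝒦 Z' t').Λ), (if |A b| < c.ε₁ then (1 : ℝ) else 0),
    fun Z' t' A => ∏ b ∈ (Finset.univ : Finset (𝔇.𝒦 Z' t').Λ), (if c.ε₁ ≤ |A b| then (1 : ℝ) else 0),
    fun _ _ _ _ _ => 0, fun _ _ _ _ _ _ => 0, fun _ _ _ => rfl, fun _ _ _ => rfl, fun _ _ _ _ _ => rfl, fun _ _ _ _ _ _ => rfl, hcardAll, ⟨?_⟩⟩
  exact
    { Uσ := univ,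
      Uτ := fun Y => ball 0 ((invTau c ((tsys P.d (L * domCount P M (k + 1))).dj Y))⁻¹ + 3),
      γ₂ := 1 / 20, rP := rP,
      qP := fun B => ∑ b ∈ (Finset.univ : Finset (𝔇.𝒦 Z t).Λ), B b ^ 2,
      kap := 3, kap' := 2, kap'' := 1, θ := 1 / 5, θE := 0, θΓ := 0, θC := 0, KG := 0, KΓ := 0, KCs := 1, K₀ := 1, KE := 1, KG' := 0, KCs' := ((1 - 1 / 12) ^ 2)⁻¹,
      θΓ' := 0,
      θC' := 1 / 12 * (2 + 1 / 12) * ((1 - 1 / 12) ^ 2)⁻¹ * 1,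
      θE' := 1 / 12 * (2 + 1 / 12), a' := 0, w' := 0, cE := 1, g := 0, Rb := 0, κ := 1 / 20, a₀ := 0, w₀ := 0, T := Mv - 1, α₀ := 0, r₁ := r₁, TP := Mv,
      ac := 1 / 20, wc := 0,
      hpos := hposY,
      hhalf := hhalfY,
      hW := isOpen_univ,
      hUσ := isOpen_univ,
      hUτ := fun _ => isOpen_ball,
      hUexp := subset_univ _,
      hUtau := fun Y => closedBall_subset_ball (by linarith),
      hr := by rw [hr1]; exact zero_lt_one,
      hr' := by rw [hr1]; linarith [Real.add_one_le_exp c.κ₁],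
      hsubτ := by
        intro Y x hx w hw
        rw [Set.uIcc_of_le zero_le_one] at hx
        rw [mem_closedBall, hr1] at hw
        rw [mem_ball, dist_zero_right]
        have hx1 : ‖(x : ℂ)‖ ≤ 1 := by rw [Complex.norm_real, Real.norm_eq_abs]; exact abs_le.2 ⟨by linarith [hx.1], hx.2⟩
        have hinv : 0 < (invTau c ((tsys P.d (L * domCount P M (k + 1))).dj Y))⁻¹ := inv_pos.2 (hposY Y)
        calc ‖w‖ = ‖(w - (x : ℂ)) + (x : ℂ)‖ := by rw [sub_add_cancel]
          _ ≤ ‖w - (x : ℂ)‖ + ‖(x : ℂ)‖ := norm_add_le _ _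
          _ ≤ 1 + 1 := add_le_add (by rw [← dist_eq_norm]; exact hw) hx1
          _ < (invTau c ((tsys P.d (L * domCount P M (k + 1))).dj Y))⁻¹ + 3 := by linarith,
      hχ0 := fun B => N22PrintedBoxBlock.chi_smul_nonneg _ ∅ c.ε₁ (fun _ => rfl) s₀ B,
      hχc0 := fun B => N22PrintedBoxBlock.chic_smul_nonneg _ Finset.univ c.ε₁ (fun _ => rfl) s₀ B,
      hχm := N22PrintedBoxBlock.measurable_chi_smul _ ∅ c.ε₁ (fun _ => rfl) s₀,
      hχcm := N22PrintedBoxBlock.measurable_chic_smul _ Finset.univ c.ε₁ (fun _ => rfl) s₀,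
      h222 := fun B => N22PrintedBoxBlock.chi_mul_chic_le_exp_222 _ _ ∅ Finset.univ c.ε₁ (fun _ => rfl) (fun _ => rfl) hs₀ (by norm_num) hrP0 hrPs
        hcardle B,
      hγ₂ := by norm_num,
      hqP := fun B => N22PrintedBoxBlock.sum_sq_le_dotProduct Finset.univ B,
      hAhol := fun _ _ i j => by simp only [hA1]; exact differentiableOn_const _,
      hGhol := fun _ _ i j => by simp only [hG0]; exact differentiableOn_const _,
      hAd := fun σ _ i j => by simp only [hA1]; exact differentiableOn_const _,
      hGd := fun σ _ i j => by simp only [hG0]; exact differentiableOn_const _,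
      hAs := fun _ _ σ _ => by rw [hA1]; exact Matrix.isSymm_one,
      hfibN := fun x => (Finset.card_filter_le _ _).trans (by rw [Finset.card_univ, hcardΛC, hm]),
      hkap'' := by norm_num,
      hk1 := by norm_num,
      hk2 := by norm_num,
      hθE := le_rfl,
      hθΓ := le_rfl,
      hθC := le_rfl,
      hKG := le_rfl,
      hKΓ := le_rfl,
      hKCs := zero_le_one,
      hK₀ := zero_le_one,
      hKE := zero_le_one,
      hG := fun _ _ σ _ b j => by rw [hG0, Matrix.zero_apply, norm_zero, zero_mul],
      hΓ₀ := fun b j => by rw [hΓ0, Matrix.zero_apply, norm_zero, zero_mul],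
      hCs := fun _ _ σ _ b b' => by
        rw [hA1, inv_one]
        by_cases hb : b = b'
        · subst hb; rw [Matrix.one_apply_eq, norm_one, tdist1_self, mul_zero, neg_zero, Real.exp_zero, mul_one]
        · rw [Matrix.one_apply_ne hb, norm_zero]; positivity,
      hC216 := fun b b' => by
        rw [hC1]
        by_cases hb : b = b'
        · subst hb; rw [Matrix.one_apply_eq, norm_one, tdist1_self, mul_zero, neg_zero, Real.exp_zero, mul_one]
        · rw [Matrix.one_apply_ne hb, norm_zero]; positivity,
      hCE := fun b b' => by
        rw [hC1, inv_one, Matrix.map_one _ (map_zero _) (map_one _)]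
        by_cases hb : b = b'
        · subst hb; rw [Matrix.one_apply_eq, norm_one, tdist1_self, mul_zero, neg_zero, Real.exp_zero, mul_one]
        · rw [Matrix.one_apply_ne hb, norm_zero]; positivity,
      hdΓ := fun _ _ σ _ b j => by rw [hG0, hΓ0, Matrix.map_zero _ (map_zero _), sub_zero, Matrix.zero_apply, norm_zero, zero_mul],
      hdC := fun _ _ σ _ b b' => by rw [hA1, hC1, inv_one, Matrix.map_one _ (map_zero _) (map_one _), sub_self, Matrix.zero_apply, norm_zero, zero_mul],
      hdE := fun _ _ σ _ b b' => by rw [hA1, hC1, inv_one, Matrix.map_one _ (map_zero _) (map_one _), sub_self, Matrix.zero_apply, norm_zero, zero_mul],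
      hKG' := by norm_num,
      hKCs' := by norm_num,
      hθΓ' := by norm_num,
      hθC' := by norm_num,
      hθE' := by norm_num,
      hθEle := by norm_num,
      hθΓle := by norm_num,
      hθR1le := by simp only [hpow, hm, Nat.cast_one, mul_one]; norm_num,
      hsmallKθ := by simp only [hpow, hm, Nat.cast_one, mul_one]; norm_num,
      hc0 := zero_le_one,
      hc := fun i => by
        haveI : Nonempty (𝔇.𝒦 Z t).Λ := ⟨i⟩
        have h : (𝔇.𝒦 Z t).hC.1.eigenvalues i ∈ spectrum ℝ (1 : Matrix (𝔇.𝒦 Z t).Λ (𝔇.𝒦 Z t).Λ ℝ) := by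
          have h0 := (𝔇.𝒦 Z t).hC.1.eigenvalues_mem_spectrum_real i
          rwa [show spectrum ℝ (𝔇.𝒦 Z t).C = spectrum ℝ (1 : Matrix (𝔇.𝒦 Z t).Λ (𝔇.𝒦 Z t).Λ ℝ) by rw [hC1]] at h0
        rw [spectrum.one_eq, Set.mem_singleton_iff] at h
        exact h.le,
      hαc := by simp only [hpow, hm, Nat.cast_one, mul_one]; norm_num,
      hg := le_rfl,
      hΓq := fun X => by rw [hΓ0, Matrix.zero_mulVec, zero_dotProduct, zero_mul],
      hsmall := by simp only [hpow, hm, Nat.cast_one, mul_one]; norm_num,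
      hPa := by nlinarith [le_max_left a 0, le_max_right a 0, ha],
      hvol := by
        have h1 : (1 : ℝ) ≤ ((Z.1).card : ℝ) := Nat.one_le_cast.mpr hZ
        simp only [hpow, hm, hcardΛ, hcardΛC, Nat.cast_one, mul_one, one_mul]
        nlinarith [h1],
      hχe := fun B => N22PrintedBoxBlock.chi_smul_neg _ ∅ c.ε₁ (fun _ => rfl) s₀ B,
      hχce := fun B => N22PrintedBoxBlock.chic_smul_neg _ Finset.univ c.ε₁ (fun _ => rfl) s₀ B,
      hαc_c := by simp only [hpow, hm, Nat.cast_one, mul_one]; norm_num,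
      hsmall_c := by simp only [hpow, hm, Nat.cast_one, mul_one]; norm_num,
      hvol_c := by
        have h1 : (1 : ℝ) ≤ ((Z.1).card : ℝ) := Nat.one_le_cast.mpr hZ
        simp only [hpow, hm, hcardΛ, hcardΛC, Nat.cast_one, mul_one, one_mul]
        nlinarith [h1],
      hχ1 := fun h => absurd h hPne,
      hκ := by norm_num,
      hboxR := fun h => absurd h hPne,
      ha₀ := le_rfl,
      hαc_b := by simp only [hpow, hm, Nat.cast_one, mul_one]; norm_num,
      hsmall_b := by simp only [hpow, hm, Nat.cast_one, mul_one]; norm_num,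
      hvol_b := by
        have h1 : (1 : ℝ) ≤ ((Z.1).card : ℝ) := Nat.one_le_cast.mpr hZ
        simp only [hpow, hm, hcardΛ, hcardΛC, Nat.cast_one, mul_one, one_mul]
        nlinarith [h1],
      hα₀ := le_rfl,
      hαc_f := by simp only [hpow, hm, Nat.cast_one, mul_one]; norm_num,
      hsmall_f := by simp only [hpow, hm, Nat.cast_one, mul_one]; norm_num,
      hr₁ := fun _ => by rw [hr₁sq]; exact ha,
      hPa1 := fun _ => by rw [hr₁sq]; nlinarith [le_max_left a 0, le_max_right a 0],
      hA := fun _ _ σ _ => by rw [hA1, Matrix.map_one _ Complex.zero_re Complex.one_re]; exact Matrix.PosDef.one,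
      hθEle0 := by norm_num,
      hθΓle0 := by norm_num,
      hθR1le0 := by simp only [hpow, hm, Nat.cast_one, mul_one]; norm_num,
      hαc_0 := by simp only [hpow, hm, Nat.cast_one, mul_one]; norm_num,
      hsmall_0 := by simp only [hpow, hm, Nat.cast_one, mul_one]; norm_num,
      hvol_0 := by
        have h1 : (1 : ℝ) ≤ ((Z.1).card : ℝ) := Nat.one_le_cast.mpr hZ
        simp only [hpow, hm, hcardΛ, hcardΛC, Nat.cast_one, mul_one, one_mul]
        nlinarith [h1],
      hRb := fun h => absurd h hPne,
      hTP := fun _ => by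
        rw [hr₁sq]
        have : -(1 / 20 / 2 * ((c.ε₁ / s₀) ^ 2 - 20 * max a 0)) = -(((c.ε₁ / s₀) ^ 2 - 20 * max a 0) / 40) := by ring
        rw [this]
        exact hMv,
      hMvT := fun h => absurd h hPne,
      hMvP := fun _ => le_rfl,
      𝒲₃ := fun _ _ => 0,
      D𝒪 := fun _ _ _ => 0,
      ρ := 1,
      hρ := zero_lt_one,
      h𝒲m := fun _ _ _ => measurable_const,
      h𝒲d := fun _ _ => differentiableOn_const _,
      h𝒲₃m := fun _ => measurable_const,
      h𝒲₃ := fun _ _ _ => by rw [mul_zero],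
      R := fun Y => (invTau c ((tsys P.d (L * domCount P M (k + 1))).dj Y))⁻¹ + 3,
      c₀ := fun _ => 0,
      c₃ := fun _ => 0,
      c₃' := fun _ => 0,
      c₄ := fun _ => 0,
      c₁ := fun _ => 0,
      c₁' := fun _ => 0,
      c₂ := fun _ => 0,
      hR := fun Y _ => by have := inv_pos.2 (hposY Y); linarith,
      hc₃ := fun _ _ => le_rfl,
      hc₃' := fun _ _ => le_rfl,
      hc₄ := fun _ _ => le_rfl,
      hc₁ := fun _ _ => le_rfl,
      hc₁' := fun _ _ => le_rfl,
      hc₂ := fun _ _ => le_rfl,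
      hUτR := fun Y _ w hw => by rw [mem_ball, dist_zero_right] at hw; exact hw.le,
      h1 := fun _ _ _ _ _ _ => by rw [norm_zero, zero_mul],
      S := fun _ => ∅,
      h1loc := fun _ _ _ _ _ _ => by rw [norm_zero, zero_mul, zero_mul],
      cubeOf := fun _ _ => 0,
      hS := fun _ _ b hb => absurd hb (Finset.notMem_empty _),
      Cp := 0,
      κp := B12TreeDecay.kappa₀ (4 * 2 ^ P.d) (2 * P.d),
      hCp := le_rfl,
      hκp := le_rfl,
      hdecay := fun _ _ => by rw [mul_zero, zero_mul],
      h2 := fun _ _ _ _ _ _ => by rw [sub_zero, norm_zero, zero_mul],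
      h3 := fun _ _ _ => by rw [norm_zero, zero_mul],
      S₀ := ∅,
      hbox := fun _ _ _ hb => absurd hb (Set.notMem_empty _),
      hloc𝒲 := fun _ _ _ _ _ _ _ => rfl,
      δ := 1 / 40,
      hδ := by norm_num,
      h𝒪m := fun _ _ _ _ _ => measurable_const,
      h𝒪d := fun _ _ _ _ => differentiableOn_const _,
      hD𝒪m := fun _ _ _ => measurable_const,
      hD𝒪 := fun _ _ _ _ _ => by rw [mul_zero],
      h0 := fun _ _ _ _ _ _ => by rw [norm_zero],
      h4 := fun _ _ _ _ _ _ _ _ => by rw [sub_zero, norm_zero, zero_mul],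
      h5 := fun _ _ _ _ _ _ _ _ => by rw [sub_zero, sub_zero, norm_zero, zero_mul],
      h6 := fun _ _ _ _ _ => by rw [norm_zero, zero_mul],
      hloc𝒪 := fun _ _ _ _ _ _ _ _ _ => rfl,
      hOhol := fun _ _ O _ cv _ _ Y A => differentiableOn_const _,
      ha' := by norm_num,
      hw' := by simp,
      hac := by norm_num,
      hwc := by simp,
      hw₀ := by simp }

/-! ## §2 Transported to the Lemma-2 record `SliceInputsL2U` (J17-W), and the A6 companion of `…PrintedBoxWindowCap` -/

open Classical in
/-- **★ `SliceInputsL2U` IS INHABITED AT A LARGE-FIELD LABEL WITH PRINT'S BOXES** (`E₀ ≥ 0`): §1's inhabitant of `SliceInputsLGU` has vanishing potentials, so J17-W's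
`SliceInputsLGU.nonempty_sliceInputsL2U_of_vanishing` transports it at `ξ₀ := 0 ∈ univ`, `old₀ := 0 ∈ AdmHist` (`zero_mem_AdmHist_of_nonneg`).  Same window relations; degenerate
kernel data; nothing of Bałaban's construction. [cite: Balaban1987RG1, (2.9) p.266; Balaban1988RG2Cluster, (2.3) p.12, (2.22) p.16 and Lemma 2 p.11 (degenerate data; bookkeeping)] -/
theorem sliceInputsL2U_inhabited_largeField_printedBoxes (hκ₁ : 1 ≤ c.κ₁) (hE : 0 < c.E₀) (hε : 0 < c.ε₁) (hC₁ : 0 < c.C₁) (hα : 0 < c.α₄) (hMc : 0 < c.M)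
    (hδκ : 0 ≤ (1 - 3 * c.δ) * c.κ) (hpref : c.E₀ * c.ε₁ * c.C₁ * c.α₄⁻¹ * c.M ^ c.q * Real.exp (c.C₂ * c.κ₁) ≤ 1 / 2)
    {G : Type*} [GaugeGroup G] (Sg : Setting 𝔸 G) (Rz : Residual P 𝔸) (cs : SFConsts) {E₀ : ℝ} (hE₀ : 0 ≤ E₀) (κE : ℝ)
    (Z : (domSys P M (k + 1)).Dom) (hZ : 1 ≤ (Z.1).card) (t : TermLabel P M k L) (hP : t.2.card = 1)
    {s₀ Mv : ℝ} (hs₀ : 0 < s₀) (a : ℝ) (ha : 20 * max a 0 ≤ (c.ε₁ / s₀) ^ 2)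
    (hMv : Real.exp (-(((c.ε₁ / s₀) ^ 2 - 20 * max a 0) / 40)) ≤ Mv * s₀ ^ 2) :
    ∃ (𝔇 : TermDatum214 c P 𝔸 M k L)
      (χu χcu : (Z : (domSys P M (k + 1)).Dom) → (t : TermLabel P M k L) → ((𝔇.𝒦 Z t).Λ → ℝ) → ℝ)
      (𝒲 : (Z : (domSys P M (k + 1)).Dom) → (t : TermLabel P M k L) → CPair P 𝔸 → TDom P.d (L * domCount P M (k + 1)) → ((𝔇.𝒦 Z t).Λ → ℝ) → ℂ)
      (𝒪 : (Z : (domSys P M (k + 1)).Dom) → (t : TermLabel P M k L) → OlderTerms P 𝔸 M k → CPair P 𝔸 → TDom P.d (L * domCount P M (k + 1)) →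
        ((𝔇.𝒦 Z t).Λ → ℝ) → ℂ),
      (∀ Z' t' A, χu Z' t' A = ∏ b ∈ (∅ : Finset (𝔇.𝒦 Z' t').Λ), (if |A b| < c.ε₁ then (1 : ℝ) else 0)) ∧
      (∀ Z' t' A, χcu Z' t' A = ∏ b ∈ (Finset.univ : Finset (𝔇.𝒦 Z' t').Λ), (if c.ε₁ ≤ |A b| then (1 : ℝ) else 0)) ∧
      (∀ Z' t', (Finset.univ : Finset (𝔇.𝒦 Z' t').Λ).card = 1) ∧
      Nonempty (SliceInputsL2U 𝔇 χu χcu 𝒲 𝒪 c Sg Rz cs E₀ κE Z t Set.univ s₀ a 2 (1 / 12) Mv) := by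
  obtain ⟨𝔇, χu, χcu, 𝒲, 𝒪, hχu, hχcu, h𝒲, h𝒪, hcard, ⟨U⟩⟩ :=
    sliceInputsLGU_inhabited_largeField_printedBoxes c P 𝔸 M k L hκ₁ hE hε hC₁ hα hMc hδκ hpref Sg Rz cs E₀ κE Z hZ t hP hs₀ a ha hMv
  exact ⟨𝔇, χu, χcu, 𝒲, 𝒪, hχu, hχcu, hcard,
    SliceInputsLGU.nonempty_sliceInputsL2U_of_vanishing U (h𝒲 Z t) (h𝒪 Z t) (Set.mem_univ (0 : CPair P 𝔸))
      (YMDAG.N22.W1.zero_mem_AdmHist_of_nonneg P 𝔸 M _ hE₀ κE)⟩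

open Classical in
/-- **A6 FOR `…PrintedBoxWindowCap` §2∕§3**: the hypotheses of `two_mul_a_mul_cE_mul_sq_le` ∕ `socket_window_cap` (an inhabitant `V` of `SliceInputsL2U` at a large-field label whose boxes
at `(Z, t)` are print's on disjoint row-bond sets `Y₀`, `Pl` with `|Pl| = |P(t)|`) are JOINTLY MET — by §2's inhabitant with `Y₀ := ∅`, `Pl := univ` — and the cap then reads
`2·a·V.cE·s₀² ≤ ε₁²` for it. [cite: Balaban1988RG2Cluster, (2.22) p.16 (degenerate data; bookkeeping)] -/
theorem windowCap_hypotheses_inhabited (hκ₁ : 1 ≤ c.κ₁) (hE : 0 < c.E₀) (hε : 0 < c.ε₁) (hC₁ : 0 < c.C₁) (hα : 0 < c.α₄) (hMc : 0 < c.M)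
    (hδκ : 0 ≤ (1 - 3 * c.δ) * c.κ) (hpref : c.E₀ * c.ε₁ * c.C₁ * c.α₄⁻¹ * c.M ^ c.q * Real.exp (c.C₂ * c.κ₁) ≤ 1 / 2)
    {G : Type*} [GaugeGroup G] (Sg : Setting 𝔸 G) (Rz : Residual P 𝔸) (cs : SFConsts) {E₀ : ℝ} (hE₀ : 0 ≤ E₀) (κE : ℝ)
    (Z : (domSys P M (k + 1)).Dom) (hZ : 1 ≤ (Z.1).card) (t : TermLabel P M k L) (hP : t.2.card = 1)
    {s₀ Mv : ℝ} (hs₀ : 0 < s₀) (a : ℝ) (ha : 20 * max a 0 ≤ (c.ε₁ / s₀) ^ 2)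
    (hMv : Real.exp (-(((c.ε₁ / s₀) ^ 2 - 20 * max a 0) / 40)) ≤ Mv * s₀ ^ 2) :
    ∃ (𝔇 : TermDatum214 c P 𝔸 M k L)
      (χu χcu : (Z : (domSys P M (k + 1)).Dom) → (t : TermLabel P M k L) → ((𝔇.𝒦 Z t).Λ → ℝ) → ℝ)
      (𝒲 : (Z : (domSys P M (k + 1)).Dom) → (t : TermLabel P M k L) → CPair P 𝔸 → TDom P.d (L * domCount P M (k + 1)) → ((𝔇.𝒦 Z t).Λ → ℝ) → ℂ)
      (𝒪 : (Z : (domSys P M (k + 1)).Dom) → (t : TermLabel P M k L) → OlderTerms P 𝔸 M k → CPair P 𝔸 → TDom P.d (L * domCount P M (k + 1)) →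
        ((𝔇.𝒦 Z t).Λ → ℝ) → ℂ)
      (Y₀ Pl : Finset (𝔇.𝒦 Z t).Λ) (V : SliceInputsL2U 𝔇 χu χcu 𝒲 𝒪 c Sg Rz cs E₀ κE Z t Set.univ s₀ a 2 (1 / 12) Mv),
      (∀ A, χu Z t A = ∏ b ∈ Y₀, (if |A b| < c.ε₁ then (1 : ℝ) else 0)) ∧
      (∀ A, χcu Z t A = ∏ b ∈ Pl, (if c.ε₁ ≤ |A b| then (1 : ℝ) else 0)) ∧
      Disjoint Y₀ Pl ∧ Pl.card = t.2.card ∧ t.2 ≠ ∅ ∧ 2 * a * V.cE * s₀ ^ 2 ≤ c.ε₁ ^ 2 := by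
  obtain ⟨𝔇, χu, χcu, 𝒲, 𝒪, hχu, hχcu, hcard1, ⟨V⟩⟩ :=
    sliceInputsL2U_inhabited_largeField_printedBoxes c P 𝔸 M k L hκ₁ hE hε hC₁ hα hMc hδκ hpref Sg Rz cs hE₀ κE Z hZ t hP hs₀ a ha hMv
  have hPne : t.2 ≠ ∅ := fun h => by rw [h, Finset.card_empty] at hP; exact Nat.zero_ne_one hP
  have hcard : (Finset.univ : Finset (𝔇.𝒦 Z t).Λ).card = t.2.card := (hcard1 Z t).trans hP.symm
  exact ⟨𝔇, χu, χcu, 𝒲, 𝒪, ∅, Finset.univ, V, hχu Z t, hχcu Z t, Finset.disjoint_empty_left _, hcard, hPne,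
    two_mul_a_mul_cE_mul_sq_le V (hχu Z t) (hχcu Z t) (Finset.disjoint_empty_left _) hcard hPne hε hs₀⟩

end Summit.QuantumFields.YangMills.BalabanUVNodes.N22PrintedBoxBlock

end
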